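import Summits.Ventures.CertifiedManyBodySolver.Rows.HomTorusMagModel
import Summits.Ventures.CertifiedManyBodySolver.Rows.TorusCeilingHom
import Summits.Ventures.CertifiedManyBodySolver.Rows.FluxTorusGaugeAut
import HarnessLib

/-!
# Torus ceiling — Part VII: the window gauge for twisted tori generated by hop vectors

HONEST FRAMING: first certified bounds; not a superconductivity verdict; every number certified or
labelled float.
For `φ : ℤ^d →+ (ℤ/N)^{d'}` injective on a window `Λ'` and a uniform Peierls field `κ : Fin d → U(1)`
(Part VI, `Rows/HomTorusMagModel.lean`), a WINDOW GAUGE `ĝ` with `ĝ(φ x) = χ(x)` (`x ∈ Λ'`; `χ` a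
character of `ℤ^d` with `χ(eᵢ) = κᵢ`, e.g. `χ(x) = ∏ᵢ κᵢ^{xᵢ}` and the fibre product
`ĝ(s) = ∏_{x ∈ Λ', φ x = s} χ(x)`) makes the gauge automorphism `Ad(W_ĝ)` composed with the second
quantisation `Γ(ι_{Λ'})` of the window carry a field-free window certificate into the twisted torus
`H_κ` (`χ`, `ĝ` are data with hypotheses here; no definitions in this file):
(i) the gauged tiling identity `Σ_v T_v (Ad(W_ĝ) Γ E_Φ) T_vᴴ = H_κ`; (ii) the `ĝ`-transformed field is
trivial on every bond meeting `φ(Λ)` (`Λ ± eᵢ ⊆ Λ'`), so the gauge defect `H_{ĝ·κ} − H_1` is an even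
element off `φ(Λ)` and EOM rows transport exactly; (iii) translation rows transport to the magnetic
translations `T_{φv} W_{χ(v)}`.  Pattern: `Rows/FluxTorusWindowGauge.lean` (square torus, flux in
direction `0`) on the hom carrier with an arbitrary twist per direction. [cite: Lieb1994, eq. (1)]
[cite: ShastrySutherland1990] [cite: Han2020Bootstrap, §3] [cite: BratteliRobinsonII1997, §5.2.2]
-/

noncomputable section

open Matrix Finset
open Literature.MathematicalPhysics.QuantumLattice
open Literature.MathematicalPhysics.QuantumFieldTheory hiding Site
open Literature.MathematicalPhysics.QuantumManyBody.StateRelaxation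
open Literature.Probability.LatticeModels
open HubbardWave0
open scoped ComplexOrder ComplexConjugate

namespace Summit.Ventures.CertifiedManyBodySolver.Rows

section WindowGauge

variable {d d' N : ℕ} [NeZero N] (φ : Site d →+ TorusSite d' N)

-- No file-level `DecidableEq` convention and no definitions in this part: the twist character `χ`
-- (`χ(x + y) = χ x · χ y`, `χ(eᵢ) = κᵢ`) and the window gauge `ĝ` (`ĝ(φ x) = χ x` for `x ∈ Λ'`) enter as DATA with their
-- defining properties as hypotheses, supplied by the caller (Part VIII takes `χ(x) = ∏ᵢ κᵢ^{xᵢ}` and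
-- the fibre product `ĝ(s) = ∏_{x ∈ Λ', φ x = s} χ(x)`, see `prod_zpow_apply_add`,
-- `prod_filter_eq_apply_of_injOn` below); the one statement naming a complement of torus orbitals
-- takes the `DecidableEq (FermionTorus d' N)` instance as a binder, so callers may use any instance.

/-! ### §1. `Ad(W_g)` and the Peierls Hamiltonian -/

/-- `Ad(W_g) H_{g·A} = H_A`. [cite: Lieb1994, eq. (1)] -/
theorem gaugeAut_homHubbardMag_homGaugeTransform (g : TorusSite d' N → Circle)
    (A : TorusSite d' N → Fin d → Circle) (t U : ℝ) :
    gaugeAut (fun u : FermionTorus d' N => g u.toTorusSite) (homHubbardMag φ (homGaugeTransform φ g A) t U) =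
      homHubbardMag φ A t U := by
  rw [gaugeAut_apply, phaseGauge_mul_homHubbardMag_mul_conjTranspose, homGaugeTransform_inv_homGaugeTransform]

/-! ### §2. Twist characters and window gauges -/

/-- A multiplicative character of `ℤ^d` takes the value `1` at `0`. [folklore] -/
theorem mulChar_zero (χ : Site d → Circle) (hχ : ∀ x y, χ (x + y) = χ x * χ y) : χ 0 = 1 := by
  have h := hχ 0 0
  rw [add_zero] at h
  exact mul_left_cancel (a := χ 0) (by rw [← h, mul_one])

/-- A multiplicative character of `ℤ^d` inverts under negation. [folklore] -/
theorem mulChar_neg (χ : Site d → Circle) (hχ : ∀ x y, χ (x + y) = χ x * χ y) (x : Site d) :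
    χ (-x) = (χ x)⁻¹ := by
  have h := hχ x (-x)
  rw [add_neg_cancel, mulChar_zero χ hχ] at h
  exact (inv_eq_of_mul_eq_one_right h.symm).symm

/-- The product character `x ↦ ∏ᵢ κᵢ^{xᵢ}` of `ℤ^d` is multiplicative. [folklore] -/
theorem prod_zpow_apply_add (κ : Fin d → Circle) (x y : Site d) :
    ∏ j, κ j ^ ((x + y) j) = (∏ j, κ j ^ (x j)) * ∏ j, κ j ^ (y j) := by
  simp [_root_.zpow_add, Finset.prod_mul_distrib]

/-- `∏ⱼ κⱼ^{(eᵢ)ⱼ} = κᵢ`. [folklore] -/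
theorem prod_zpow_apply_unitVec (κ : Fin d → Circle) (i : Fin d) : ∏ j, κ j ^ (unitVec i j) = κ i := by
  rw [Finset.prod_eq_single i (fun j _ hj => by
      rw [show unitVec i j = 0 from Pi.single_eq_of_ne hj _, zpow_zero])
    (fun h => absurd (Finset.mem_univ i) h),
    show unitVec i i = 1 from Pi.single_eq_same _ _, zpow_one]

omit [NeZero N] in
/-- The **fibre-product window gauge** `s ↦ ∏_{y ∈ Λ', φ y = s} χ(y)` takes the value `χ(x)` at
`φ x`, `x ∈ Λ'`, when `φ` is injective on `Λ'` (and `1` off `φ(Λ')`): a choice-free window gauge.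
[cite: ShastrySutherland1990] -/
theorem prod_filter_eq_apply_of_injOn (χ : Site d → Circle) {Λ' : Finset (Site d)}
    (hInj' : Set.InjOn φ ↑Λ') {x : Site d} (hx : x ∈ Λ') :
    ∏ y ∈ Λ'.filter (fun y => φ y = φ x), χ y = χ x := by
  have hfilter : Λ'.filter (fun y => φ y = φ x) = {x} := by
    ext y
    simp only [Finset.mem_filter, Finset.mem_singleton]
    constructor
    · rintro ⟨hy, he⟩
      exact hInj' hy hx he
    · rintro rfl
      exact ⟨hx, rfl⟩
  rw [hfilter, Finset.prod_singleton]

/-- A window gauge composed with the site map of `S ⊆ Λ'`: `ĝ(homEmb y) = χ(y)`. [folklore] -/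
theorem windowGauge_homEmb (χ : Site d → Circle) (ĝ : TorusSite d' N → Circle) {S Λ' : Finset (Site d)}
    (hS : S ⊆ Λ') (hInj' : Set.InjOn φ ↑Λ') (hĝ : ∀ x ∈ Λ', ĝ (φ x) = χ x) (y : PolySite S) :
    ĝ ((homEmb φ (hInj'.mono (by exact_mod_cast hS)) y).toTorusSite) = χ (ofLex y.1) := by
  rw [homEmb_apply, FermionTorus.toTorusSite_ofTorusSite]
  exact hĝ _ (hS (PolySite.ofLex_mem y))

/-! ### §3. The gauged tiling identity -/

/-- **Gauged tiling identity**: for a window `Λ' ⊇ thicken {0} 1` on which `φ` is injective, the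
torus translates of the GAUGED embedded energy-density observable `Ad(W_ĝ) Γ(ι_{Λ'}) Γ(incl) E_Φ`
(ANY window gauge `ĝ`, `ĝ(φ x) = χ(x)` on `Λ'`, `χ` a character with `χ(eᵢ) = κᵢ`) sum to the UNIFORMLY twisted Peierls Hamiltonian `H_κ` (phase `κᵢ`
on every `φ(eᵢ)`-hop). [cite: Lieb1994, eq. (1)] [cite: Han2020Bootstrap, §3] -/
theorem sum_fockTranslate_gaugeAut_homEmb_meanEnergyObs (t U : ℝ) (κ : Fin d → Circle) (χ : Site d → Circle)
    (hχ : ∀ x y, χ (x + y) = χ x * χ y) (hχe : ∀ i, χ (unitVec i) = κ i) (ĝ : TorusSite d' N → Circle)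
    {Λ' : Finset (Site d)} (h0 : thicken ({0} : Finset (Site d)) 1 ⊆ Λ') (hInj' : Set.InjOn φ ↑Λ')
    (hĝ : ∀ x ∈ Λ', ĝ (φ x) = χ x) :
    ∑ v : TorusSite d' N, (fockTranslate v).val *
        gaugeAut (fun u : FermionTorus d' N => ĝ u.toTorusSite)
          (fermionEmbed (homEmb φ hInj')
            (fermionEmbed (PolySite.incl h0) ((hubbardFermionInteraction d t U).meanEnergyObs 1))) *
        (fockTranslate v).valᴴ =
      homHubbardMag φ (fun _ => κ) t U := by
  -- elaborate the torus identities with the order-derived `DecidableEq` (the instance the generic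
  -- CAR operators and `Ad(W_g)` carry); the statement does not depend on the instance
  letI instDE : DecidableEq (FermionTorus d' N) := LinearOrder.toDecidableEq
  set ĝ' : FermionTorus d' N → Circle := fun u => ĝ u.toTorusSite with hĝ'
  have hInj0 : Set.InjOn φ ↑(thicken ({0} : Finset (Site d)) 1) := hInj'.mono (by exact_mod_cast h0)
  -- abbreviations for the torus operators
  set o : TorusSite d' N → FermionTorus d' N := FermionTorus.ofTorusSite with ho
  set cd : TorusSite d' N → Fin 2 → Matrix (Finset (Orb (FermionTorus d' N))) (Finset (Orb (FermionTorus d' N))) ℂ :=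
    fun x σ => creation (orb (o x) σ) with hcd
  set c : TorusSite d' N → Fin 2 → Matrix (Finset (Orb (FermionTorus d' N))) (Finset (Orb (FermionTorus d' N))) ℂ :=
    fun x σ => annihilation (orb (o x) σ) with hc
  set nn : TorusSite d' N → Matrix (Finset (Orb (FermionTorus d' N))) (Finset (Orb (FermionTorus d' N))) ℂ :=
    fun x => numberOp (o x) 0 * numberOp (o x) 1 with hnn
  -- the window gauge at `0` and `±φ(eᵢ)`
  have hg0 : (ĝ' (FermionTorus.ofTorusSite (0 : TorusSite d' N)) : ℂ) = 1 := by
    rw [hĝ']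
    dsimp only
    rw [FermionTorus.toTorusSite_ofTorusSite, ← map_zero φ, hĝ _ (h0 (zero_mem_thicken_zero 1)),
      mulChar_zero χ hχ, Circle.coe_one]
  have hgp : ∀ i : Fin d, (ĝ' (FermionTorus.ofTorusSite (φ (unitVec i))) : ℂ) = (κ i : ℂ) := by
    intro i
    rw [hĝ']
    dsimp only
    rw [FermionTorus.toTorusSite_ofTorusSite, hĝ _ (h0 (unitVec_mem_thicken_one i)), hχe]
  have hgm : ∀ i : Fin d, (ĝ' (FermionTorus.ofTorusSite (-φ (unitVec i))) : ℂ) = conj (κ i : ℂ) := by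
    intro i
    rw [hĝ']
    dsimp only
    rw [FermionTorus.toTorusSite_ofTorusSite, ← map_neg, hĝ _ (h0 (neg_unitVec_mem_thicken_one i)),
      mulChar_neg χ hχ, hχe, Circle.coe_inv_eq_conj]
  have hcomm : ∀ (w : TorusSite d' N) (i : Fin d), φ (unitVec i) + w = w + φ (unitVec i) :=
    fun w i => add_comm _ _
  -- the translate by `v` of the gauged window energy density
  have htrans : ∀ v : TorusSite d' N, (fockTranslate v).val *
      gaugeAut ĝ' (fermionEmbed (homEmb φ hInj')
        (fermionEmbed (PolySite.incl h0) ((hubbardFermionInteraction d t U).meanEnergyObs 1))) *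
      (fockTranslate v).valᴴ =
      (U : ℂ) • nn v + ∑ i : Fin d, ((2 : ℂ)⁻¹ * -(t : ℂ)) • ∑ σ : Fin 2,
        ((conj (κ i : ℂ) • (cd v σ * c (v + φ (unitVec i)) σ) +
            (κ i : ℂ) • (cd (v + φ (unitVec i)) σ * c v σ)) +
          (conj (κ i : ℂ) • (cd (v - φ (unitVec i)) σ * c v σ) +
            (κ i : ℂ) • (cd v σ * c (v - φ (unitVec i)) σ))) := by
    intro v
    rw [← relabel_eq_fockRelabel_conj, fermionEmbed_homEmb_incl φ h0 hInj',
      fermionEmbed_homEmb_hubbard_meanEnergyObs φ t U hInj0]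
    simp only [map_add, map_smul, map_sum, map_mul, gaugeAut_creation_orb, gaugeAut_annihilation_orb,
      gaugeAut_numberOp, hg0, hgp, hgm, map_one, one_smul, Complex.conj_conj,
      relabel_translate_creation, relabel_translate_annihilation,
      relabel_translate_numberOp, zero_add, neg_add_eq_sub, hcomm, smul_mul_assoc, mul_smul_comm]
    rfl
  simp_rw [htrans]
  rw [Finset.sum_add_distrib, ← Finset.smul_sum, Finset.sum_comm]
  have hH : homHubbardMag φ (fun _ => κ) t U =
      -(t : ℂ) • (∑ x : TorusSite d' N, ∑ i : Fin d, ∑ σ : Fin 2,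
        ((κ i : ℂ) • (cd (x + φ (unitVec i)) σ * c x σ) + conj (κ i : ℂ) • (cd x σ * c (x + φ (unitVec i)) σ))) +
        (U : ℂ) • ∑ x : TorusSite d' N, nn x :=
    homHubbardMag_eq_sum_torusSite φ (fun _ => κ) t U
  rw [hH, add_comm]
  refine congrArg₂ (fun S T => S + (U : ℂ) • T) ?_ rfl
  simp only [Finset.smul_sum]
  conv_rhs => rw [Finset.sum_comm]
  refine Finset.sum_congr rfl fun i _ => ?_
  have hshift1 : ∑ v : TorusSite d' N, ∑ σ : Fin 2, ((2 : ℂ)⁻¹ * -(t : ℂ)) •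
      (conj (κ i : ℂ) • (cd (v - φ (unitVec i)) σ * c v σ)) =
      ∑ v : TorusSite d' N, ∑ σ : Fin 2, ((2 : ℂ)⁻¹ * -(t : ℂ)) •
        (conj (κ i : ℂ) • (cd v σ * c (v + φ (unitVec i)) σ)) :=
    TorusSite.sum_sub_shift (φ (unitVec i))
      (fun a b => ∑ σ : Fin 2, ((2 : ℂ)⁻¹ * -(t : ℂ)) • (conj (κ i : ℂ) • (cd b σ * c a σ)))
  have hshift2 : ∑ v : TorusSite d' N, ∑ σ : Fin 2, ((2 : ℂ)⁻¹ * -(t : ℂ)) •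
      ((κ i : ℂ) • (cd v σ * c (v - φ (unitVec i)) σ)) =
      ∑ v : TorusSite d' N, ∑ σ : Fin 2, ((2 : ℂ)⁻¹ * -(t : ℂ)) •
        ((κ i : ℂ) • (cd (v + φ (unitVec i)) σ * c v σ)) :=
    TorusSite.sum_sub_shift (φ (unitVec i))
      (fun a b => ∑ σ : Fin 2, ((2 : ℂ)⁻¹ * -(t : ℂ)) • ((κ i : ℂ) • (cd a σ * c b σ)))
  simp only [smul_add, Finset.sum_add_distrib]
  rw [hshift1, hshift2]
  have ha : ∀ z : ℂ, -(t : ℂ) * z = (2 : ℂ)⁻¹ * -(t : ℂ) * z + (2 : ℂ)⁻¹ * -(t : ℂ) * z := fun z => by ring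
  simp only [smul_smul, ← Finset.smul_sum]
  rw [ha, ha, add_smul, add_smul]
  abel

/-! ### §4. The gauged field is trivial on every bond the EOM rows see -/

omit [NeZero N] in
/-- **A window gauge removes the uniform field near `φ(Λ)`**: if `x = φ z` or `x + φ(eᵢ) = φ z`
for some `z ∈ Λ` (with `Λ ± eᵢ ⊆ Λ'`, `ĝ(φ y) = χ(y)` on `Λ'`), the `ĝ`-transform of the uniform
field `κ` is `1` on the bond `(x, i)`: both endpoints are images of `Λ'`-points differing by `eᵢ`,
and `χ(z₀) κᵢ χ(z₀ + eᵢ)⁻¹ = 1`. [cite: Lieb1994, eq. (1)] -/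
theorem homGaugeTransform_windowGauge_eq_one (κ : Fin d → Circle) (χ : Site d → Circle)
    (hχ : ∀ x y, χ (x + y) = χ x * χ y) (hχe : ∀ i, χ (unitVec i) = κ i) (ĝ : TorusSite d' N → Circle)
    {Λ Λ' : Finset (Site d)} (hΛ : Λ ⊆ Λ')
    (hclosed : ∀ x ∈ Λ, ∀ i : Fin d, x + unitVec i ∈ Λ' ∧ x - unitVec i ∈ Λ')
    (hĝ : ∀ x ∈ Λ', ĝ (φ x) = χ x) (x : TorusSite d' N) (i : Fin d)
    (h : (∃ z ∈ Λ, x = φ z) ∨ (∃ z ∈ Λ, x + φ (unitVec i) = φ z)) :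
    homGaugeTransform φ ĝ (fun _ => κ) x i = 1 := by
  obtain ⟨z₀, hz₀, hz₁, hx⟩ : ∃ z₀ : Site d, z₀ ∈ Λ' ∧ z₀ + unitVec i ∈ Λ' ∧ x = φ z₀ := by
    rcases h with ⟨z, hz, hx'⟩ | ⟨z, hz, hx'⟩
    · exact ⟨z, hΛ hz, (hclosed z hz i).1, hx'⟩
    · refine ⟨z - unitVec i, (hclosed z hz i).2, by rw [sub_add_cancel]; exact hΛ hz, ?_⟩
      rw [map_sub, ← hx', add_sub_cancel_right]
  have hshift : x + φ (unitVec i) = φ (z₀ + unitVec i) := by rw [map_add, hx]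
  simp only [homGaugeTransform]
  rw [hshift, hx, hĝ _ hz₀, hĝ _ hz₁, hχ, hχe]
  exact mul_inv_cancel _

/-- **The gauge defect is localised away from `φ(Λ)`**: `H_{ĝ·κ} − H_1` lies in the EVEN CAR algebra
of the orbitals off `φ(Λ)` (bond by bond: a bond one of whose endpoints is in `φ(Λ)` carries the
trivial transformed field by `homGaugeTransform_windowGauge_eq_one`; any other bond term
`c†_{yσ} c_{xσ}` is an even element supported off `φ(Λ)`). The `DecidableEq` instance of the
complement is a binder (callers may use any). [cite: BratteliRobinsonII1997, §5.2.2] -/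
theorem homHubbardMag_windowGauge_sub_one_mem [DecidableEq (FermionTorus d' N)] (t U : ℝ) (κ : Fin d → Circle)
    (χ : Site d → Circle) (hχ : ∀ x y, χ (x + y) = χ x * χ y) (hχe : ∀ i, χ (unitVec i) = κ i)
    (ĝ : TorusSite d' N → Circle) {Λ Λ' : Finset (Site d)}
    (hΛ : Λ ⊆ Λ') (hclosed : ∀ x ∈ Λ, ∀ i : Fin d, x + unitVec i ∈ Λ' ∧ x - unitVec i ∈ Λ')
    (hInj' : Set.InjOn φ ↑Λ') (hĝ : ∀ x ∈ Λ', ĝ (φ x) = χ x) :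
    homHubbardMag φ (homGaugeTransform φ ĝ (fun _ => κ)) t U - homHubbardMag φ 1 t U ∈
      carEvenSubalgebra (orbs ((Finset.univ : Finset (PolySite Λ)).map
        ((PolySite.incl hΛ).trans (homEmb φ hInj'))))ᶜ := by
  -- the statement is parametric in the instance; work with the order-derived one
  obtain rfl : ‹DecidableEq (FermionTorus d' N)› = LinearOrder.toDecidableEq := Subsingleton.elim _ _
  letI instDE : DecidableEq (FermionTorus d' N) := LinearOrder.toDecidableEq
  -- orbitals at torus sites that are not images of `Λ` lie in the complement
  have hmem : ∀ y : TorusSite d' N, (∀ z ∈ Λ, y ≠ φ z) → ∀ τ : Fin 2,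
      orb (FermionTorus.ofTorusSite y) τ ∈ (orbs ((Finset.univ : Finset (PolySite Λ)).map
        ((PolySite.incl hΛ).trans (homEmb φ hInj'))))ᶜ := by
    intro y hy τ
    refine Finset.mem_compl.2 fun h' => ?_
    obtain ⟨p, -, hp⟩ := Finset.mem_map.1 (orb_mem_orbs.1 h')
    have h2 : FermionTorus.ofTorusSite (φ (ofLex p.1)) = FermionTorus.ofTorusSite y := by
      rw [← hp, Function.Embedding.trans_apply, homEmb_apply, PolySite.coe_incl]
    have h3 := congrArg FermionTorus.toTorusSite h2
    rw [FermionTorus.toTorusSite_ofTorusSite, FermionTorus.toTorusSite_ofTorusSite] at h3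
    exact hy (ofLex p.1) (PolySite.ofLex_mem p) h3.symm
  set A' := homGaugeTransform φ ĝ (fun _ => κ) with hA'
  unfold homHubbardMag
  rw [add_sub_add_right_eq_sub, ← smul_sub]
  refine SMulMemClass.smul_mem _ ?_
  rw [← Finset.sum_sub_distrib]
  refine sum_mem fun x _ => ?_
  rw [← Finset.sum_sub_distrib]
  refine sum_mem fun i _ => ?_
  rw [← Finset.sum_sub_distrib]
  refine sum_mem fun σ _ => ?_
  by_cases h : (∃ z ∈ Λ, x = φ z) ∨ (∃ z ∈ Λ, x + φ (unitVec i) = φ z)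
  · have h1 : A' x i = 1 := homGaugeTransform_windowGauge_eq_one φ κ χ hχ hχe ĝ hΛ hclosed hĝ x i h
    rw [h1, Pi.one_apply, Pi.one_apply, sub_self]
    exact zero_mem _
  · push Not at h
    have hxS : ∀ τ, orb (FermionTorus.ofTorusSite x) τ ∈ (orbs ((Finset.univ : Finset (PolySite Λ)).map
        ((PolySite.incl hΛ).trans (homEmb φ hInj'))))ᶜ := hmem x h.1
    have hyS : ∀ τ, orb (FermionTorus.ofTorusSite (x + φ (unitVec i))) τ ∈
        (orbs ((Finset.univ : Finset (PolySite Λ)).map ((PolySite.incl hΛ).trans (homEmb φ hInj'))))ᶜ :=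
      hmem _ h.2
    refine sub_mem (add_mem (SMulMemClass.smul_mem _ ?_) (SMulMemClass.smul_mem _ ?_))
      (add_mem (SMulMemClass.smul_mem _ ?_) (SMulMemClass.smul_mem _ ?_))
    · exact creation_mul_annihilation_mem_carEvenSubalgebra (hyS σ) (hxS σ)
    · exact creation_mul_annihilation_mem_carEvenSubalgebra (hxS σ) (hyS σ)
    · exact creation_mul_annihilation_mem_carEvenSubalgebra (hyS σ) (hxS σ)
    · exact creation_mul_annihilation_mem_carEvenSubalgebra (hxS σ) (hyS σ)

/-! ### §5. Transport of the EOM and translation rows through `Ad(W_ĝ) ∘ Γ(ι_{Λ'})` -/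

/-- **EOM rows in the twisted torus**: `Φ = Ad(W_ĝ) ∘ Γ(ι_{Λ'})` carries the window commutator
`[h_{Λ'}, Γ(incl) B]` (`B ∈ 𝔄_Λ`, all neighbours of `Λ` in `Λ'`, non-degenerate hops) to the torus
commutator `[H_κ, Φ(Γ(incl) B)]`: `H_κ = Ad(W_ĝ)(H_{ĝ·κ})`, `H_{ĝ·κ} = H_1 + (defect commuting with
Γ(ι)Γ(incl)B)`, `H_1 = homHubbard φ`, and the field-free sharp transport of Part II.
[cite: Han2020Bootstrap, §3] [cite: Lieb1994, eq. (1)] -/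
theorem homHubbardMag_commutator_gaugeAut_fermionEmbed (t U : ℝ) (κ : Fin d → Circle) (χ : Site d → Circle)
    (hχ : ∀ x y, χ (x + y) = χ x * χ y) (hχe : ∀ i, χ (unitVec i) = κ i) (ĝ : TorusSite d' N → Circle)
    (hd : Function.Injective (signedHop φ)) {Λ Λ' : Finset (Site d)} (hΛ : Λ ⊆ Λ')
    (hclosed : ∀ x ∈ Λ, ∀ i : Fin d, x + unitVec i ∈ Λ' ∧ x - unitVec i ∈ Λ')
    (hInj' : Set.InjOn φ ↑Λ') (hĝ : ∀ x ∈ Λ', ĝ (φ x) = χ x) (B : FermionOp Λ) :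
    homHubbardMag φ (fun _ => κ) t U *
          gaugeAut (fun u : FermionTorus d' N => ĝ u.toTorusSite)
            (fermionEmbed (homEmb φ hInj') (fermionEmbed (PolySite.incl hΛ) B)) -
        gaugeAut (fun u : FermionTorus d' N => ĝ u.toTorusSite)
            (fermionEmbed (homEmb φ hInj') (fermionEmbed (PolySite.incl hΛ) B)) *
          homHubbardMag φ (fun _ => κ) t U =
      gaugeAut (fun u : FermionTorus d' N => ĝ u.toTorusSite)
        (fermionEmbed (homEmb φ hInj')
          ((hubbardFermionInteraction d t U).localHamiltonian Λ' * fermionEmbed (PolySite.incl hΛ) B -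
            fermionEmbed (PolySite.incl hΛ) B * (hubbardFermionInteraction d t U).localHamiltonian Λ')) := by
  set ĝ' : FermionTorus d' N → Circle := fun u => ĝ u.toTorusSite with hĝ'
  letI instDE : DecidableEq (FermionTorus d' N) := LinearOrder.toDecidableEq
  set H' := homHubbardMag φ (homGaugeTransform φ ĝ (fun _ => κ)) t U with hH'
  set Z := fermionEmbed (homEmb φ hInj') (fermionEmbed (PolySite.incl hΛ) B) with hZ
  have hgauge : homHubbardMag φ (fun _ => κ) t U = gaugeAut ĝ' H' :=
    (gaugeAut_homHubbardMag_homGaugeTransform φ ĝ (fun _ => κ) t U).symm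
  have hcomm : (H' - homHubbard φ t U) * Z = Z * (H' - homHubbard φ t U) := by
    have hm := homHubbardMag_windowGauge_sub_one_mem φ t U κ χ hχ hχe ĝ hΛ hclosed hInj' hĝ
    rw [homHubbardMag_one_eq_homHubbard φ hd t U] at hm
    rw [hZ, fermionEmbed_fermionEmbed]
    exact (commute_of_mem_carEvenSubalgebra hm (fermionEmbed_mem_carSubalgebra _ B) disjoint_compl_left).eq
  have hsharp := homHubbard_commutator_fermionEmbed φ t U hΛ hclosed hInj' B
  rw [← hZ] at hsharp
  rw [hgauge, ← map_mul (gaugeAut ĝ'), ← map_mul (gaugeAut ĝ'), ← map_sub (gaugeAut ĝ'), ← hsharp]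
  congr 1
  have e : H' = homHubbard φ t U + (H' - homHubbard φ t U) := by abel
  rw [e, Matrix.add_mul, Matrix.mul_add, hcomm]
  abel

/-- **Translation rows in the twisted torus**: `Φ = Ad(W_ĝ) ∘ Γ(ι_{Λ'})` carries the window row
`Γ(incl')(τ_v Y) − Γ(incl) Y` (`Y ∈ 𝔄_Λ`, `Λ + v ⊆ Λ'`) to `U (Ad(W_ĝ) Γ(ι_Λ) Y) Uᴴ − Ad(W_ĝ) Γ(ι_Λ) Y`
with the MAGNETIC TRANSLATION `U = T_{φ v} · W_{χ(v)}` (a symmetry of `H_κ`): the window gauge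
picks up the constant phase `χ(v)` under the shift. [cite: Lieb1994, eq. (1)] -/
theorem gaugeAut_homEmb_shift_sub (χ : Site d → Circle) (hχ : ∀ x y, χ (x + y) = χ x * χ y)
    (ĝ : TorusSite d' N → Circle) {Λ Λ' : Finset (Site d)} (hΛ : Λ ⊆ Λ') (v : Site d)
    (hsh : shiftSet v Λ ⊆ Λ') (hInj' : Set.InjOn φ ↑Λ') (hĝ : ∀ x ∈ Λ', ĝ (φ x) = χ x) (Y : FermionOp Λ) :
    gaugeAut (fun u : FermionTorus d' N => ĝ u.toTorusSite)
        (fermionEmbed (homEmb φ hInj')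
          (fermionEmbed (PolySite.incl hsh) (fermionEmbed (PolySite.shiftEmb v Λ) Y) -
            fermionEmbed (PolySite.incl hΛ) Y)) =
      ((fockTranslate (φ v)).val * phaseGauge (fun _ : FermionTorus d' N => χ v)) *
          gaugeAut (fun u : FermionTorus d' N => ĝ u.toTorusSite)
            (fermionEmbed (homEmb φ (hInj'.mono (by exact_mod_cast hΛ))) Y) *
          ((fockTranslate (φ v)).val * phaseGauge (fun _ : FermionTorus d' N => χ v))ᴴ -
        gaugeAut (fun u : FermionTorus d' N => ĝ u.toTorusSite)
          (fermionEmbed (homEmb φ (hInj'.mono (by exact_mod_cast hΛ))) Y) := by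
  letI instDE : DecidableEq (FermionTorus d' N) := LinearOrder.toDecidableEq
  set ĝ' : FermionTorus d' N → Circle := fun u => ĝ u.toTorusSite with hĝ'
  set cv : Circle := χ v with hcv
  have hInjΛ : Set.InjOn φ ↑Λ := hInj'.mono (by exact_mod_cast hΛ)
  have hInjS : Set.InjOn φ ↑(shiftSet v Λ) := hInj'.mono (by exact_mod_cast hsh)
  -- on `Λ`, the window gauge pulled back along the shift is the constant `χ_κ(v)` times the window gauge
  have hfun : (ĝ' ∘ ⇑(homEmb φ hInjS)) ∘ ⇑(PolySite.shiftEmb v Λ) = (fun _ => cv) * (ĝ' ∘ ⇑(homEmb φ hInjΛ)) := by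
    funext y
    simp only [Function.comp_apply, Pi.mul_apply, hĝ']
    rw [windowGauge_homEmb φ χ ĝ hsh hInj' hĝ, windowGauge_homEmb φ χ ĝ hΛ hInj' hĝ, hcv,
      PolySite.ofLex_coe_shiftEmb, hχ, mul_comm]
  rw [map_sub, fermionEmbed_homEmb_incl φ hsh hInj', fermionEmbed_homEmb_incl φ hΛ hInj', map_sub,
    gaugeAut_fermionEmbed ĝ' (homEmb φ hInjS), gaugeAut_fermionEmbed, hfun, gaugeAut_mul_apply,
    fermionEmbed_homEmb_shiftEmb φ v hInjΛ hInjS, relabel_eq_fockRelabel_conj]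
  have hconst : fermionEmbed (homEmb φ hInjΛ)
      (gaugeAut (fun _ : PolySite Λ => cv) (gaugeAut (ĝ' ∘ ⇑(homEmb φ hInjΛ)) Y)) =
      gaugeAut (fun _ : FermionTorus d' N => cv) (gaugeAut ĝ' (fermionEmbed (homEmb φ hInjΛ) Y)) := by
    rw [gaugeAut_fermionEmbed ĝ', gaugeAut_fermionEmbed (fun _ : FermionTorus d' N => cv)]
    rfl
  rw [hconst, gaugeAut_apply (fun _ : FermionTorus d' N => cv), conjTranspose_mul]
  simp only [Matrix.mul_assoc]

end WindowGauge

end Summit.Ventures.CertifiedManyBodySolver.Rows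

end
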